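import Summits.QuantumFields.YangMills.Theorems.FluctuationComparisonRegPrIntLS2BetaLocalOfSupTower
import HarnessLib

/-!
# S2β (line g18-1, organ GAP♯∘, letter AVG₂♭-ax_q, sup chain) — FILE 2″: LOC″ ⟸ (ST″), the (BKG) EDITIONS of the two letters
# (one extra hypothesis on the background `U₀` alone: its averaged towers' plaquettes decay `L^{−2}` per level toward the finest)

Cell `ym3-torus`, seat `ym3-torus-px17` g22 (architect; ruling «(ST″) YES» 2026-08-31T18:56Z on px16 g23's HAZARD «SRC-θ»), crux `stmt-QuantumFields-20520`
`FluctuationComparisonRegPrIntL`, line g18-1 `semiclassical_s2beta` (registry sha16 3732b7df, UNTOUCHED), organ `stub_uniformFibreGapOrbit` (GAP♯∘).  Count-neutral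
helper; 0 `def`, 0 `sorry`.

WHY.  The curl row of the lift ladder carries a ZEROTH-ORDER source `θ̃_{u+1}·‖X‖` whose coefficients are the BACKGROUND's plaquette sizes; composed through the
ladder's kernel (row sums `L²` per level) it is summable only if those sizes decay faster than `L^{−1}` per level — false for a merely `θ`-good history, true
for the constrained MINIMISER, whose averaged towers' plaquettes decay `L^{−2}` per level ((BKG), [Balaban1985Averaging] Prop. 4 keeps the spacing factor `L^{j−k}`
on every background term).  Downstream, AVG₂♭-ax_q (✓p825995's `hM`) quantifies over the minimiser set only, so the letters LOC ∕ (ST) may carry (BKG) as ONE extra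
hypothesis on `U₀` alone (the partner `expPoint ζ • U₀` shares `θ` and does not decay, so (BKG) is not a `θ`-guard).  This file is ✓p829725 `loc_of_supTowerLetter`
with that binder threaded through both letters (and `∀ C_B ≥ 0, ∃ α₀ > 0` added to the constant prefix, `α ≤ α₀` to the guards); the fixed-data
theorem ✓`local_of_supTower` is used UNCHANGED — (BKG) is not consumed here, only passed.

THE EDITS OF RECORD (px16 g23's bytes 18:59:22Z + addendum 19:02:39Z, adopted by the architect): (E1) constant prefix `∀ (L : ℕ), 1 < L → ∀ (C_B : ℝ), 0 ≤ C_B →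
∃ α₀ : ℝ, 0 < α₀ ∧ ∃ C_… ≥ 0, …` (suppliers' constants may depend on `C_B`; absorption needs `C_B·α` SMALL, whence the extra window `α₀`, discharged at
the knit by shrinking `γ₁` after `C_B`); (E1′) the guard `α ≤ α₀ →` right after `157 * α < ((F.L : ℝ) ^ 2)⁻¹ →`; (E2) the (BKG) binder immediately after `U₀ ∈ histGood F ℰp θ K J →`:
`(∀ t, t ≤ K − J → ∀ p : Plaq (F.P K) t, dist1 (GaugeField.plaqHol (Averaging.iter (fun k => BlockAveraging.blockAvg (P := F.P K) (j := k) ℰp) t U₀) p) ≤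
   C_B * α * (F.L : ℝ) ^ (2 * t) * ((F.L : ℝ)⁻¹) ^ (2 * (K − J))) →`.

WHAT IS PROVED: ★ `loc_of_supTowerLetter''` — hSTL″ ⟹ hLoc″ (both = the texts of record e7ed31ae ∕ d049f1fb with (E1)(E1′)(E2) inserted; every other byte
identical; constants as in ✓p829725).

HONEST FRAMING.  Bookkeeping; (BKG), (ST″), LOC″ are HYPOTHESES∕letters; nothing of Bałaban's analysis is proved here; GAP♯∘, S2-β, crux 20520, `YM3TorusSU2` NOT
proved.  INHABITATION (RULING №100): the letters are GAP♯-prefix-shaped implications between two Prop-valued hypotheses; no inhabitant is claimed.  Rung R3 =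
SU(2) YM₃ on T³ — NOT d = 4, NOT infinite volume, NOT a mass gap, NOT Clay.
-/

noncomputable section

open scoped Matrix.Norms.L2Operator Topology RealInnerProductSpace Quaternion
open Set Function
open Literature.MathematicalPhysics.QuantumLattice (su2Quat)
open Literature.MathematicalPhysics.QuantumFieldTheory.Balaban1983to89
open Literature.MathematicalPhysics.QuantumFieldTheory.Balaban1983to89.T3ContinuumYM3Torus
open Literature.MathematicalPhysics.QuantumFieldTheory.Balaban1983to89.T3UnitLawDensityEML (ℰp)
open Literature.MathematicalPhysics.QuantumFieldTheory.Balaban1983to89.T3UnitScaleTilt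
open Literature.MathematicalPhysics.QuantumFieldTheory.Balaban1983to89.T3TiltDescent
open Literature.MathematicalPhysics.QuantumFieldTheory.Balaban1983to89.T3DescentFibreTower
open Literature.MathematicalPhysics.QuantumFieldTheory.Balaban1983to89.T3LevelShift
open Literature.MathematicalPhysics.QuantumFieldTheory.Balaban1983to89.ExpMeanLog (deltaSU)
open Literature.MathematicalPhysics.QuantumFieldTheory.Balaban1983to89.T4HaarSU2ExpChart (expPoint)
open Literature.MathematicalPhysics.QuantumFieldTheory.Balaban1983to89.T4ExpWindowSmallField (imVec logVec)
open Literature.MathematicalPhysics.QuantumFieldTheory.Balaban1983to89.T4Continuum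

namespace Summit.QuantumFields.YangMills.Theorems.FluctuationComparisonRegPrIntLS2BetaLocalOfSupTowerBkg

open FluctuationComparisonRegPrIntLS2BetaLocalOfSupTower (local_of_supTower)

variable {F : T3Family}

/-- ★★★ **LOC″ ⟸ (ST″)**: ✓p829725 `loc_of_supTowerLetter` with the (BKG) hypothesis on the background threaded through both letters (see the module docstring).
[cite: Balaban1985Averaging, Prop. 4 (128)-(135) pp.37-38, (148)-(149) p.40; Balaban1987RG1, (0.11) p.253] -/
theorem loc_of_supTowerLetter''
    (G : (F : T3Family) → (J : ℕ) → GaugeField (F.P J) 0 (Matrix.specialUnitaryGroup (Fin 2) ℂ) → Prop)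
    (Ax : (F : T3Family) → (J K : ℕ) → (hJK : J ≤ K) → GaugeField (F.P K) 0 (Matrix.specialUnitaryGroup (Fin 2) ℂ) →
      GaugeField (F.P K) 0 (Matrix.specialUnitaryGroup (Fin 2) ℂ) → Prop)
    (hSTL'' : ∀ (L : ℕ), 1 < L → ∀ (C_B : ℝ), 0 ≤ C_B → ∃ α₀ : ℝ, 0 < α₀ ∧ ∃ C_ST : ℝ, 0 ≤ C_ST ∧ ∃ c_ST : ℝ, 0 ≤ c_ST ∧ ∀ (F : T3Family), F.L = L →
      ∀ (J K : ℕ) (hJK : J ≤ K) (θ : ℕ → ℝ), (∀ i, 0 ≤ θ i) → ∀ (α : ℝ), (∀ i, J < i → i ≤ K → (((5 * F.L : ℕ) : ℝ) ^ 2 / 4) * θ i ≤ α) →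
        α ≤ 1 / 24 → α < deltaSU (Fin 2) → 157 * α < ((F.L : ℝ) ^ 2)⁻¹ → α ≤ α₀ →
        ∀ U₀ : GaugeField (F.P K) 0 (Matrix.specialUnitaryGroup (Fin 2) ℂ), U₀ ∈ histGood F ℰp θ K J →
        (∀ t, t ≤ K - J → ∀ p : Plaq (F.P K) t,
            dist1 (GaugeField.plaqHol (Averaging.iter (fun k => BlockAveraging.blockAvg (P := F.P K) (j := k) ℰp) t U₀) p) ≤
              C_B * α * (F.L : ℝ) ^ (2 * t) * ((F.L : ℝ)⁻¹) ^ (2 * (K - J))) →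
        ∀ ζ : PBond (F.P K) 0 → EuclideanSpace ℝ (Fin 3), (∀ ℓ, ‖ζ ℓ‖ ≤ Real.pi) →
          (fun ℓ => expPoint (ζ ℓ) * U₀ ℓ : GaugeField (F.P K) 0 (Matrix.specialUnitaryGroup (Fin 2) ℂ)) ∈ histGood F ℰp θ K J →
            Ax F J K hJK (fun ℓ => expPoint (ζ ℓ) * U₀ ℓ) U₀ →
            ∑ t ∈ Finset.range (K - J), (if ht : t < K - J then
          (F.L : ℝ) ^ t * ∑ B : PBond (F.P J) 0,
            ‖(fun ℓ' : PBond (F.P (J + (t + 1))) 0 =>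
              if ∃ b : PBond (F.P (J + t)) 0,
                ((B14.Eq22Determines.blockIter (J + t - J) b.src = (bondShift (F.sitesPerDir_eq (m := F.m) (K := J) (j := 0) (m' := F.m) (K' := J + t) (j' := J + t - J) (by omega)) B).src ∨ B14.Eq22Determines.blockIter (J + t - J) b.src = (bondShift (F.sitesPerDir_eq (m := F.m) (K := J) (j := 0) (m' := F.m) (K' := J + t) (j' := J + t - J) (by omega)) B).tgt) ∧
                (B14.Eq22Determines.blockIter (J + t - J) b.tgt = (bondShift (F.sitesPerDir_eq (m := F.m) (K := J) (j := 0) (m' := F.m) (K' := J + t) (j' := J + t - J) (by omega)) B).src ∨ B14.Eq22Determines.blockIter (J + t - J) b.tgt = (bondShift (F.sitesPerDir_eq (m := F.m) (K := J) (j := 0) (m' := F.m) (K' := J + t) (j' := J + t - J) (by omega)) B).tgt)) ∧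
                (blockOf ℓ'.src = (bondShift (F.sitesPerDir_eq (m := F.m) (K := J + t) (j := 0) (m' := F.m) (K' := J + t + 1) (j' := 1) (by omega)) b).src ∨ blockOf ℓ'.src = (bondShift (F.sitesPerDir_eq (m := F.m) (K := J + t) (j := 0) (m' := F.m) (K' := J + t + 1) (j' := 1) (by omega)) b).tgt)
              then logVec (su2Quat (descendTo F ℰp (J + (t + 1)) K (by omega) (fun ℓ => expPoint (ζ ℓ) * U₀ ℓ : GaugeField (F.P K) 0 (Matrix.specialUnitaryGroup (Fin 2) ℂ)) ℓ' * (descendTo F ℰp (J + (t + 1)) K (by omega) U₀ ℓ')⁻¹)) else 0)‖ ^ 2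
        else 0) ≤
              C_ST * Real.exp (c_ST * ∑ i ∈ Finset.range (K - J), (((5 * F.L : ℕ) : ℝ) ^ 2 / 4) * θ (K - i)) * (((F.L : ℝ)⁻¹) ^ (K - J) * ∑ ℓ : PBond (F.P K) 0, ‖ζ ℓ‖ ^ 2 +
                (F.L : ℝ) ^ (K - J) * ∑ p : Plaq (F.P K) 0,
                  (1 - reTr ((GaugeField.plaqHol U₀ p)⁻¹ * GaugeField.plaqHol (fun ℓ => expPoint (ζ ℓ) * U₀ ℓ : GaugeField (F.P K) 0 (Matrix.specialUnitaryGroup (Fin 2) ℂ)) p)))) :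
    ∀ (L : ℕ), 1 < L → ∀ (C_B : ℝ), 0 ≤ C_B → ∃ α₀ : ℝ, 0 < α₀ ∧ ∃ C_T : ℝ, 0 ≤ C_T ∧ ∃ c : ℝ, 0 ≤ c ∧ ∀ (F : T3Family), F.L = L →
      ∀ (J K : ℕ) (hJK : J ≤ K) (θ : ℕ → ℝ), (∀ i, 0 ≤ θ i) → ∀ (α : ℝ), (∀ i, J < i → i ≤ K → (((5 * F.L : ℕ) : ℝ) ^ 2 / 4) * θ i ≤ α) →
        α ≤ 1 / 24 → α < deltaSU (Fin 2) → 157 * α < ((F.L : ℝ) ^ 2)⁻¹ → α ≤ α₀ →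
        ∀ U₀ : GaugeField (F.P K) 0 (Matrix.specialUnitaryGroup (Fin 2) ℂ), U₀ ∈ histGood F ℰp θ K J →
        (∀ t, t ≤ K - J → ∀ p : Plaq (F.P K) t,
            dist1 (GaugeField.plaqHol (Averaging.iter (fun k => BlockAveraging.blockAvg (P := F.P K) (j := k) ℰp) t U₀) p) ≤
              C_B * α * (F.L : ℝ) ^ (2 * t) * ((F.L : ℝ)⁻¹) ^ (2 * (K - J))) →
        ∀ ζ : PBond (F.P K) 0 → EuclideanSpace ℝ (Fin 3), (∀ ℓ, ‖ζ ℓ‖ ≤ Real.pi) →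
          (fun ℓ => expPoint (ζ ℓ) * U₀ ℓ : GaugeField (F.P K) 0 (Matrix.specialUnitaryGroup (Fin 2) ℂ)) ∈ histGood F ℰp θ K J →
            Ax F J K hJK (fun ℓ => expPoint (ζ ℓ) * U₀ ℓ) U₀ →
            ∑ B : PBond (F.P J) 0, ‖imVec (su2Quat (descendTo F ℰp J K hJK (fun ℓ => expPoint (ζ ℓ) * U₀ ℓ) B * (descendTo F ℰp J K hJK U₀ B)⁻¹)) -
                (fderiv ℝ (fun (ζ : PBond (F.P K) 0 → EuclideanSpace ℝ (Fin 3)) (B : PBond (F.P J) 0) =>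
                  imVec (su2Quat (descendTo F ℰp J K hJK (fun ℓ => expPoint (ζ ℓ) * U₀ ℓ) B * (descendTo F ℰp J K hJK U₀ B)⁻¹))) 0)
                  (fun ℓ => Real.sinc ‖ζ ℓ‖ • ζ ℓ) B‖ ≤
              C_T * Real.exp (c * ∑ i ∈ Finset.range (K - J), (((5 * F.L : ℕ) : ℝ) ^ 2 / 4) * θ (K - i)) * (((F.L : ℝ)⁻¹) ^ (K - J) * ∑ ℓ : PBond (F.P K) 0, ‖ζ ℓ‖ ^ 2 +
                (F.L : ℝ) ^ (K - J) * ∑ p : Plaq (F.P K) 0,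
                  (1 - reTr ((GaugeField.plaqHol U₀ p)⁻¹ * GaugeField.plaqHol (fun ℓ => expPoint (ζ ℓ) * U₀ ℓ : GaugeField (F.P K) 0 (Matrix.specialUnitaryGroup (Fin 2) ℂ)) p)))   := by
  have _hG := G
  intro L hL C_B hCB
  obtain ⟨α₀, hα₀, C_ST, hCST, c_ST, hcST, H⟩ := hSTL'' L hL C_B hCB
  refine ⟨α₀, hα₀, (1 + 4 * ((3 + 2 : ℕ) : ℝ)) * (4551000 * ((5 * L : ℕ) : ℝ) ^ 2) * C_ST, by positivity,
    ((3 + 2 : ℕ) : ℝ) * (422 + 1616 * ((3 + 2 : ℕ) : ℝ)) + c_ST, by positivity, ?_⟩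
  intro F hF J K hJK θ hθ0 α hθα hα24 hαδ hαL hαα₀ U₀ hUg hBKG ζ hζ hWg hAx
  have key := local_of_supTower (F := F) hJK hθ0 hθα hα24 hαδ hαL hUg ζ C_ST c_ST
    (H F hF J K hJK θ hθ0 α hθα hα24 hαδ hαL hαα₀ U₀ hUg hBKG ζ hζ hWg hAx)
  have hC : (1 + 4 * ((3 + 2 : ℕ) : ℝ)) * (4551000 * ((5 * L : ℕ) : ℝ) ^ 2) * C_ST =
      (1 + 4 * ((3 + 2 : ℕ) : ℝ)) * (4551000 * ((5 * F.L : ℕ) : ℝ) ^ 2) * C_ST := by rw [hF]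
  rw [hC]
  exact key

end Summit.QuantumFields.YangMills.Theorems.FluctuationComparisonRegPrIntLS2BetaLocalOfSupTowerBkg

end
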